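import Literature.AnabelianGeometry.EtaleTheta.SettingModelCyclotomicCharacterNontrivial
import Literature.AnabelianGeometry.EtaleTheta.RootsOfUnityGaloisNontrivial
import Literature.AnabelianGeometry.EtaleTheta.RootsOfUnityGaloisNontrivialOddPrime
import Literature.AnabelianGeometry.EtaleTheta.ZHatLevelDetermination
import HarnessLib

/-!
# The mod-`N` cyclotomic character `χ_N = levelChar N ∘ χ : G_{ℚ_p} → ℤ/Nℤ` is NON-TRIVIAL for `p² ∣ N`
# (and for `p ∣ N` when `p` is odd) — proof-only

J.-P. Serre, *Local Fields*, IV §4 Prop. 17 (`ℚ_p(ζ_{pⁿ})/ℚ_p` is totally ramified of degree `φ(pⁿ)`; in the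
tree: abc-iut-w5-d125's `exists_isPrimitiveRoot_sq_and_apply_ne` / `exists_isPrimitiveRoot_prime_and_apply_ne`,
files `RootsOfUnityGaloisNontrivial(OddPrime)`) [cite: SerreLocalFields1979, IV §4 Prop 17]; S. Mochizuki, [EtTh]
§1 p. 13 ("`K_N := K(ζ_N, q_X^{1/N})`"; `G_K` acts on `μ_N` through the cyclotomic character)
[cite: MochizukiEtTh2009, §1 p.13].

abc-iut cell, layer L2, seat abc-iut-w5-d091 (gen 5); R78 cluster, file F3 addendum 3 (the leftover recorded by
gen 4).  PROOF-ONLY (no definition, no instance, no named fact).  F3 (`SettingModelCyclotomicCharacter`) gives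
`σ(μ) = μ ^ χ_N(σ)` for every `N`-th root of unity `μ ∈ ℚ̄_p` (`apply_eq_pow_levelChar_chi`); F3 addendum 2
(`SettingModelCyclotomicCharacterNontrivial`) gives `χ(σ) ≠ 1` on every open subgroup.  Here the FINITE-LEVEL
form the stage-2 congruence subgroups `U_N = {χ_N(σ) = 1 ∧ …}` of the χ-models are cut out by:

* `levelChar_chi_ne_one_of_apply_ne` — if `σ` moves SOME `N`-th root of unity then `χ_N(σ) ≠ 1`
  (and conversely `χ_N(σ) = 1 ⇒ σ` fixes every `N`-th root of unity, `apply_eq_self_of_levelChar_chi_eq_one`);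
* **`exists_levelChar_chi_ne_one_of_sq_dvd`** — for every `N` with `p² ∣ N` some `σ ∈ G_{ℚ_p}` has `χ_N(σ) ≠ 1`
  (all primes `p`, incl. `p = 2`: "`i ∉ ℚ₂`"), i.e. `levelChar N ∘ χ ≠ 1` (`levelChar_comp_chi_ne_one_of_sq_dvd`) and
  the open subgroup `{σ | χ_N(σ) = 1}` (F3's `isOpen_setOf_levelChar_chi_eq_one`) is PROPER;
* **`exists_levelChar_chi_ne_one_of_dvd`** — for ODD `p` already `p ∣ N` suffices (`ζ_p ∉ ℚ_p`);
* `exists_mem_levelChar_chi_ne_one_of_isOpen` — on every OPEN `U ≤ G_{ℚ_p}` some `σ ∈ U` has `χ_n(σ) ≠ 1` at SOME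
  level `n` (addendum 2 + abc-iut-w4-d024's `ZHatLevel.levelChar_ne_of_ne`: `Aut(Ẑ) → ∏_n (ℤ/nℤ)` is injective).
Nothing of [EtTh] is asserted; no side is taken on [IUTchIII] Cor. 3.12; a model is consistency evidence only.
-/

noncomputable section

open CategoryTheory ProfiniteGrp ProfiniteGrp.ProfiniteCompletion

namespace Literature.AnabelianGeometry.EtaleTheta.SettingModel

open Literature.AnabelianGeometry.SemiGraphs (GQp)

variable (p : ℕ) [hp : Fact p.Prime]

/-! ### `χ_N(σ) = 1` iff `σ` fixes the `N`-th roots of unity -/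

/-- If `χ_N(σ) = 1` then `σ` fixes EVERY `N`-th root of unity `μ ∈ ℚ̄_p` (`σ(μ) = μ ^ χ_N(σ) = μ ^ 1`).
[cite: MochizukiEtTh2009, §1 p.13] -/
theorem apply_eq_self_of_levelChar_chi_eq_one (σ : GQp p) (N : ℕ+) {μ : PadicAlgCl p} (hμ : μ ^ (N : ℕ) = 1)
    (h : ZHatLevel.levelChar N (chi p σ) = 1) : σ μ = μ := by
  rw [apply_eq_pow_levelChar_chi p σ N hμ, h, ZMod.val_one_eq_one_mod, ← pow_eq_pow_mod 1 hμ, pow_one]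

/-- Contrapositive: **if `σ` moves some `N`-th root of unity then `χ_N(σ) ≠ 1`.** [cite: MochizukiEtTh2009, §1 p.13] -/
theorem levelChar_chi_ne_one_of_apply_ne (σ : GQp p) (N : ℕ+) {μ : PadicAlgCl p} (hμ : μ ^ (N : ℕ) = 1)
    (hne : σ μ ≠ μ) : ZHatLevel.levelChar N (chi p σ) ≠ 1 :=
  fun h => hne (apply_eq_self_of_levelChar_chi_eq_one p σ N hμ h)

/-- Conversely, if `σ` fixes a PRIMITIVE `N`-th root of unity then `χ_N(σ) = 1` (F3's
`levelChar_chi_eq_of_isPrimitiveRoot` at exponent `1`). [cite: MochizukiEtTh2009, §1 p.13] -/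
theorem levelChar_chi_eq_one_of_apply_eq (σ : GQp p) (N : ℕ+) {ξ : PadicAlgCl p} (hξ : IsPrimitiveRoot ξ N)
    (h : σ ξ = ξ) : ZHatLevel.levelChar N (chi p σ) = 1 := by
  rw [levelChar_chi_eq_of_isPrimitiveRoot p σ N hξ (c := 1) (by rw [pow_one]; exact h), Nat.cast_one]

/-! ### Level `p²` (every prime `p`) -/

/-- **For `p² ∣ N` some `σ ∈ G_{ℚ_p}` has `χ_N(σ) ≠ 1`**: `G_{ℚ_p}` moves a primitive `p²`-th root of unity
(`ℚ_p(ζ_{p²}) ≠ ℚ_p`, abc-iut-w5-d125's `exists_isPrimitiveRoot_sq_and_apply_ne`), which is an `N`-th root of unity.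
[cite: SerreLocalFields1979, IV §4 Prop 17] -/
theorem exists_levelChar_chi_ne_one_of_sq_dvd (N : ℕ+) (hN : p ^ 2 ∣ (N : ℕ)) :
    ∃ σ : GQp p, ZHatLevel.levelChar N (chi p σ) ≠ 1 := by
  obtain ⟨ζ, σ, hζ, hσ⟩ := exists_isPrimitiveRoot_sq_and_apply_ne p
  refine ⟨σ, levelChar_chi_ne_one_of_apply_ne p σ N ?_ hσ⟩
  obtain ⟨k, hk⟩ := hN
  rw [hk, pow_mul, hζ.pow_eq_one, one_pow]

/-- Hence **`χ_N = levelChar N ∘ χ : G_{ℚ_p} → ℤ/Nℤ` is not the trivial homomorphism for `p² ∣ N`.**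
[cite: SerreLocalFields1979, IV §4 Prop 17] -/
theorem levelChar_comp_chi_ne_one_of_sq_dvd (N : ℕ+) (hN : p ^ 2 ∣ (N : ℕ)) :
    (ZHatLevel.levelChar N).comp (chi p) ≠ 1 := by
  intro h
  obtain ⟨σ, hσ⟩ := exists_levelChar_chi_ne_one_of_sq_dvd p N hN
  exact hσ (by rw [← MonoidHom.comp_apply, h, MonoidHom.one_apply])

/-- In particular at level `N = p²` itself. [cite: SerreLocalFields1979, IV §4 Prop 17] -/
theorem exists_levelChar_sq_chi_ne_one :
    ∃ σ : GQp p, ZHatLevel.levelChar ⟨p ^ 2, pow_pos hp.out.pos 2⟩ (chi p σ) ≠ 1 :=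
  exists_levelChar_chi_ne_one_of_sq_dvd p _ dvd_rfl

/-- The open subgroup `{σ | χ_N(σ) = 1}` of `G_{ℚ_p}` (F3's `isOpen_setOf_levelChar_chi_eq_one`) is PROPER when
`p² ∣ N`. [cite: SerreLocalFields1979, IV §4 Prop 17] -/
theorem setOf_levelChar_chi_eq_one_ne_univ_of_sq_dvd (N : ℕ+) (hN : p ^ 2 ∣ (N : ℕ)) :
    {σ : GQp p | ZHatLevel.levelChar N (chi p σ) = 1} ≠ Set.univ := by
  obtain ⟨σ, hσ⟩ := exists_levelChar_chi_ne_one_of_sq_dvd p N hN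
  exact fun h => hσ (Set.eq_univ_iff_forall.mp h σ)

/-! ### Level `p` (odd primes `p`) -/

/-- **For ODD `p` and `p ∣ N` some `σ ∈ G_{ℚ_p}` has `χ_N(σ) ≠ 1`**: `G_{ℚ_p}` moves a primitive `p`-th root of
unity (`ζ_p ∉ ℚ_p`, abc-iut-w5-d125's `exists_isPrimitiveRoot_prime_and_apply_ne`). [cite: SerreLocalFields1979, IV §4 Prop 17] -/
theorem exists_levelChar_chi_ne_one_of_dvd (hp2 : p ≠ 2) (N : ℕ+) (hN : p ∣ (N : ℕ)) :
    ∃ σ : GQp p, ZHatLevel.levelChar N (chi p σ) ≠ 1 := by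
  obtain ⟨ζ, σ, hζ, hσ⟩ := exists_isPrimitiveRoot_prime_and_apply_ne p hp2
  refine ⟨σ, levelChar_chi_ne_one_of_apply_ne p σ N ?_ hσ⟩
  obtain ⟨k, hk⟩ := hN
  rw [hk, pow_mul, hζ.pow_eq_one, one_pow]

/-- Hence for odd `p ∣ N`, `χ_N = levelChar N ∘ χ ≠ 1`. [cite: SerreLocalFields1979, IV §4 Prop 17] -/
theorem levelChar_comp_chi_ne_one_of_dvd (hp2 : p ≠ 2) (N : ℕ+) (hN : p ∣ (N : ℕ)) :
    (ZHatLevel.levelChar N).comp (chi p) ≠ 1 := by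
  intro h
  obtain ⟨σ, hσ⟩ := exists_levelChar_chi_ne_one_of_dvd p hp2 N hN
  exact hσ (by rw [← MonoidHom.comp_apply, h, MonoidHom.one_apply])

/-- … and the open subgroup `{σ | χ_N(σ) = 1}` is PROPER for odd `p ∣ N`. [cite: SerreLocalFields1979, IV §4 Prop 17] -/
theorem setOf_levelChar_chi_eq_one_ne_univ_of_dvd (hp2 : p ≠ 2) (N : ℕ+) (hN : p ∣ (N : ℕ)) :
    {σ : GQp p | ZHatLevel.levelChar N (chi p σ) = 1} ≠ Set.univ := by
  obtain ⟨σ, hσ⟩ := exists_levelChar_chi_ne_one_of_dvd p hp2 N hN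
  exact fun h => hσ (Set.eq_univ_iff_forall.mp h σ)

/-! ### On open subgroups: some level is non-trivial -/

/-- **On every OPEN `U ≤ G_{ℚ_p}` some `σ ∈ U` has `χ_n(σ) ≠ 1` at SOME level `n`**: F3 addendum 2 gives `σ ∈ U`
with `χ(σ) ≠ 1` in `Aut(Ẑ)`, and `Aut(Ẑ) ↪ ∏_n ℤ/nℤ` is injective on level characters
(`ZHatLevel.levelChar_ne_of_ne`). (At a FIXED level `N` this fails for small `U`, e.g. `U = G_{ℚ_p(μ_N)}`.)
[cite: NeukirchANT1999, Ch. II Prop. (5.7) (i)] -/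
theorem exists_mem_levelChar_chi_ne_one_of_isOpen (U : Subgroup (GQp p)) (hU : IsOpen (U : Set (GQp p))) :
    ∃ σ ∈ U, ∃ n : ℕ+, ZHatLevel.levelChar n (chi p σ) ≠ 1 := by
  obtain ⟨σ, hσU, hσ⟩ := exists_mem_chi_ne_one_of_isOpen p U hU
  obtain ⟨n, hn⟩ := ZHatLevel.levelChar_ne_of_ne hσ
  exact ⟨σ, hσU, n, by rwa [map_one] at hn⟩

/-- In particular some `σ ∈ G_{ℚ_p}` and some level `n` have `χ_n(σ) ≠ 1` (also immediate from the level-`p²`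
statement). [cite: NeukirchANT1999, Ch. II Prop. (5.7) (i)] -/
theorem exists_levelChar_chi_ne_one : ∃ (σ : GQp p) (n : ℕ+), ZHatLevel.levelChar n (chi p σ) ≠ 1 := by
  obtain ⟨σ, hσ⟩ := exists_levelChar_sq_chi_ne_one p
  exact ⟨σ, _, hσ⟩

end Literature.AnabelianGeometry.EtaleTheta.SettingModel

end
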